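import Summits.CriticalPhenomena.PercolationContinuityZ3.Theorems.SahiMasterFamilyPrincipalCapBetaSmall
import Summits.CriticalPhenomena.PercolationContinuityZ3.Theorems.PercNearOneGluingNoHeavyLowerTailSahiJoinAbsorption
import Summits.CriticalPhenomena.PercolationContinuityZ3.Theorems.SahiMasterFamily
import Literature.Combinatorics.Sahi2008.FixedCycle

/-!
# The inductive step on the principal-cap stratum, EVERY order: `C_{≤k} ⇒ C_{k+1}` for families of increasing
# events whose common part is principal (only the sub-families avoiding ONE member are needed)

Unit `prim-masterthm-p4` (gen 13; crux anchor stmt-CriticalPhenomena-4575, helper work; memo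
`run/shared/lean/prim/prim-masterthm/prim-masterthm-p4/P4-GEN13-REPORT.md` §1, "block form / conditional step").
Companion of `…PrincipalCapBeta` (β-normal form `E_{k+1} = (∏ P_j)·Φ_{k+1}(β)`, all orders) and `…PrincipalCapBetaSmall`
(every set function is the moment function of the canonical SIGNED model `realW β`, `realF`).

**THEOREM (abstract, all orders)** `phiSet_nonneg_of_subfamilies`.  Let `β : Finset (Fin (k+1)) → ℝ` with `β ≤ 1`,
`β univ = 1`, and suppose the HONEST SUB-FUNCTIONALS avoiding the last index are nonnegative:
`Φ_{n+1}(S ↦ β(e(S))) ≥ 0` for every embedding `e : Fin (n+1) ↪ Fin (k+1)` missing `Fin.last k`.  Then `Φ_{k+1}(β) ≥ 0`.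
(No supermultiplicativity and no sign condition on `β` is used.)

**THEOREM (events, all orders)** `sahiE_ind_nonneg_principalCap_of_subfamilies` /
`sahiE_ind_nonneg_principalCap_of_masterFamilyNonneg`: for every finite product of two-point spaces `μ_p`, every `k` and
every `k+1` increasing events `U_0,…,U_k` whose common part `⋂ U_j` is a PRINCIPAL up-set: if Sahi's functional is
nonnegative on every sub-family avoiding one fixed member (in particular if `MasterFamilyNonneg (n+1)` = Sahi's `C_{n+1}`
holds for all `n + 1 ≤ k`), then `E_{k+1}(μ_p; 1_{U_0},…,1_{U_k}) ≥ 0`.  Equivalently: **a counterexample to Sahi's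
conjecture over product measures of minimal order never lies on the principal-cap stratum.**

MECHANISM (memo §1 "block form"; two printed ingredients and one new one).
(1) Lieb–Sahi's block expansion along the cycle through a fixed index [LiebSahi2021, Prop. 3.4 and p. 8]
(`CycleForm.sahiE_eq_sum_blocks`), applied in the canonical signed model of `β`:
`Φ_{k+1}(β) = Σ_{B ∋ last} (|B|−1)!·β_B·c_B`, `c_univ = 1`, `c_B = −Φ(β|_{Bᶜ}) ≤ 0` otherwise (hypothesis); with `β_B ≤ 1`
this gives `Φ_{k+1}(β) ≥ Σ_{B ∋ last} (|B|−1)!·c_B`.  (2) The right-hand side is Sahi's `E_{k+1}` — in the SAME signed model —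
of the family in which the last coordinate indicator is replaced by the indicator `f` of the top point (which is absorbed by
all the others and has `E f = β univ = 1`), so by the join-absorption factorisation of seat p5 (`…SahiJoinAbsorption`,
[LiebSahi2021, Prop. 3.3 / Lemma 3.2]) it equals the absorption factor `Φ_1(h) = Σ_{σ ∈ S_k} ∏_{c ∈ cyc σ} (1 − β_c)`.
(3) NEW: `absorbFactor_one_nonneg_of_moments` — that factor is `≥ 0` under ANY signed weight as soon as all mixed moments are
`≤ 1` (induction along its insertion recursion; the merged families have moments among the original ones, by
`CycleForm.prod_liftBlock`).  For events the hypothesis `c_B ≤ 0` is `C_{|Bᶜ|}` for the sub-family `Bᶜ` via the β-normal form.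
HONEST FRAMING: a CONDITIONAL inductive step (a reduction of `C_{k+1}` on the stratum to `C_{≤k}` off it); Sahi's `C_k` /
Kahn's Conjecture 5 / the master theorem remain OPEN for `k ≥ 3`; unconditionally the tree has `C_n` on the principal-cap
stratum for `n ≤ 6` (`…PrincipalCapLeSix`).  Axioms standard. [this work]
-/

noncomputable section

open scoped Classical

namespace Summit.CriticalPhenomena.PercolationContinuityZ3.Theorems

namespace PrincipalCapStep

open Finset Function
open Literature.Combinatorics.Sahi2008
open Literature.Combinatorics.Sahi2008.CycleForm
open Literature.Probability.Percolation.DecisionTree (ind ind_nonneg)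
open PrincipalCapBeta (phiSet realF realW)

/-! ### The absorption factor is nonnegative under moment bounds alone (any signed weight) -/

section Factor

variable {α : Type*} [Fintype α]

/-- `liftBlock e S ⊇ succ(S)`, so it is nonempty when `S` is. [folklore] -/
theorem liftBlock_nonempty {m : ℕ} (e : Fin m) {S : Finset (Fin m)} (hS : S.Nonempty) : (liftBlock e S).Nonempty := by
  have h : S.map (Fin.succEmb m) ⊆ liftBlock e S := by
    unfold liftBlock
    split_ifs
    · exact subset_insert _ _
    · exact Subset.rfl
  exact (hS.map).mono h

/-- **The absorption factor `Φ_1(h) = Σ_{σ∈S_m} ∏_{c ∈ cyc σ} (1 − E ∏_{i∈c} h_i)` is nonnegative under ANY (signed) weight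
as soon as every mixed moment `E(∏_{i∈S} h_i)`, `S ≠ ∅`, is at most `1`** (induction along the insertion recursion
`absorbFactor_succ`; the merged families have moments among the original ones). [this work] -/
theorem absorbFactor_one_nonneg_of_moments (μ : α → ℝ) :
    ∀ (m : ℕ) (h : Fin m → α → ℝ), (∀ S : Finset (Fin m), S.Nonempty → ex μ (∏ i ∈ S, h i) ≤ 1) →
      0 ≤ SahiJoinAbsorption.absorbFactor μ 1 m h
  | 0, h, _ => by rw [SahiJoinAbsorption.absorbFactor_zero]; exact zero_le_one
  | m + 1, h, hmom => by
    rw [SahiJoinAbsorption.absorbFactor_succ]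
    have h0 : ex μ (h 0) ≤ 1 := by
      have := hmom {0} ⟨0, mem_singleton_self 0⟩
      rwa [prod_singleton] at this
    have htail : ∀ S : Finset (Fin m), S.Nonempty → ex μ (∏ i ∈ S, Fin.tail h i) ≤ 1 := by
      intro S hS
      have e1 : (∏ i ∈ S, Fin.tail h i) = ∏ i ∈ S.map (Fin.succEmb m), h i := by
        rw [prod_map]; rfl
      rw [e1]
      exact hmom _ (hS.map)
    have hupd : ∀ (e : Fin m) (S : Finset (Fin m)), S.Nonempty →
        ex μ (∏ i ∈ S, update (Fin.tail h) e (Fin.tail h e * h 0) i) ≤ 1 := by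
      intro e S hS
      have key : (∏ i ∈ S, update (Fin.tail h) e (Fin.tail h e * h 0) i) = ∏ i ∈ liftBlock e S, h i := by
        funext x
        rw [Finset.prod_apply, Finset.prod_apply, prod_liftBlock]
      rw [key]
      exact hmom _ (liftBlock_nonempty e hS)
    exact add_nonneg (mul_nonneg (sub_nonneg.2 h0) (absorbFactor_one_nonneg_of_moments μ m _ htail))
      (sum_nonneg fun e _ => absorbFactor_one_nonneg_of_moments μ m _ (hupd e))

end Factor

/-! ### The comparison family in the canonical signed model: the last indicator replaced by the top point -/

section Model

variable {k : ℕ}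

/-! The comparison family is `Fin.snoc (fun j : Fin k => realF j.castSucc) (∏ i, realF i)`: the first `k` coordinate
indicators `1_{j ∈ ·}` (the "absorbers") followed by the indicator of the top point `univ` (the product of ALL coordinate
indicators, the "absorbed head").  No auxiliary definitions are introduced (proof-only devices). -/

/-- The product of all coordinate indicators is the indicator of the top point. [this work] -/
theorem fTop_apply (S : Finset (Fin (k + 1))) : (∏ i : Fin (k + 1), realF i) S = if S = univ then 1 else 0 := by
  rw [PrincipalCapBeta.prod_realF_apply]
  simp only [Finset.univ_subset_iff]

/-- Every coordinate indicator is `1` at the top point. [this work] -/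
theorem realF_univ (j : Fin (k + 1)) : realF j univ = 1 := by
  unfold PrincipalCapBeta.realF
  rw [if_pos (mem_univ _)]

/-- The head is absorbed by every absorber: `1_{univ} · 1_{j∈·} = 1_{univ}`. [this work] -/
theorem fTop_mul_realF (j : Fin k) :
    (∏ i : Fin (k + 1), realF i) * (fun j : Fin k => realF j.castSucc) j = ∏ i : Fin (k + 1), realF i := by
  funext S
  rw [Pi.mul_apply, fTop_apply]
  split_ifs with hS
  · rw [hS]
    show 1 * realF j.castSucc univ = 1
    rw [realF_univ, one_mul]
  · rw [zero_mul]

/-- The comparison family on the first `k` slots. [this work] -/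
theorem gFam_castSucc (j : Fin k) :
    (Fin.snoc (fun j : Fin k => realF j.castSucc) (∏ i : Fin (k + 1), realF i) :
      Fin (k + 1) → Finset (Fin (k + 1)) → ℝ) j.castSucc = realF j.castSucc :=
  Fin.snoc_castSucc (α := fun _ => Finset (Fin (k + 1)) → ℝ) _ _ _

/-- The comparison family on the last slot. [this work] -/
theorem gFam_last :
    (Fin.snoc (fun j : Fin k => realF j.castSucc) (∏ i : Fin (k + 1), realF i) :
      Fin (k + 1) → Finset (Fin (k + 1)) → ℝ) (Fin.last k) = ∏ i : Fin (k + 1), realF i :=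
  Fin.snoc_last _ _

/-- Every member of the comparison family is `1` at the top point. [this work] -/
theorem gFam_univ (j : Fin (k + 1)) :
    (Fin.snoc (fun j : Fin k => realF j.castSucc) (∏ i : Fin (k + 1), realF i) :
      Fin (k + 1) → Finset (Fin (k + 1)) → ℝ) j univ = 1 := by
  refine Fin.lastCases ?_ (fun j' => ?_) j
  · rw [gFam_last, fTop_apply, if_pos rfl]
  · rw [gFam_castSucc, realF_univ]

/-- Moments of the absorbers: `E_{realW β}(∏_{i∈S} 1_{castSucc i ∈ ·}) = β(castSucc(S))`. [this work] -/
theorem ex_prod_realF_castSucc (β : Finset (Fin (k + 1)) → ℝ) (S : Finset (Fin k)) :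
    ex (realW β) (∏ i ∈ S, (fun j : Fin k => realF j.castSucc) i) = β (S.map Fin.castSuccEmb) := by
  have e1 : (∏ i ∈ S, (fun j : Fin k => realF j.castSucc) i) =
      ∏ x ∈ S.map Fin.castSuccEmb, (realF x : Finset (Fin (k + 1)) → ℝ) := by
    rw [prod_map]; rfl
  rw [e1, PrincipalCapBeta.ex_realW_prod]

/-- The head has mass `β univ`. [this work] -/
theorem ex_fTop (β : Finset (Fin (k + 1)) → ℝ) : ex (realW β) (∏ i : Fin (k + 1), realF i) = β univ :=
  PrincipalCapBeta.ex_realW_prod β univ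

/-- A product of members of the comparison family containing the head IS the head. [this work] -/
theorem prod_gFam_eq_fTop {B : Finset (Fin (k + 1))} (hB : Fin.last k ∈ B) :
    (∏ j ∈ B, (Fin.snoc (fun j : Fin k => realF j.castSucc) (∏ i : Fin (k + 1), realF i) :
      Fin (k + 1) → Finset (Fin (k + 1)) → ℝ) j) = ∏ i : Fin (k + 1), realF i := by
  funext S
  rw [Finset.prod_apply, fTop_apply]
  by_cases hS : S = univ
  · rw [if_pos hS, hS]
    exact prod_eq_one fun j _ => gFam_univ j
  · rw [if_neg hS]
    exact prod_eq_zero hB (by rw [gFam_last, fTop_apply, if_neg hS])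

/-- Off the last slot the comparison family is the coordinate family, so the complementary factors of a block containing
the last index agree. [this work] -/
theorem coRest_gFam_eq (μ : Finset (Fin (k + 1)) → ℝ) {B : Finset (Fin (k + 1))} (hB : Fin.last k ∈ B) :
    coRest μ (Fin.snoc (fun j : Fin k => realF j.castSucc) (∏ i : Fin (k + 1), realF i) :
      Fin (k + 1) → Finset (Fin (k + 1)) → ℝ) B = coRest μ realF B := by
  have e1 : (fun j : {x // x ∉ B} => (Fin.snoc (fun j : Fin k => realF j.castSucc) (∏ i : Fin (k + 1), realF i) :
      Fin (k + 1) → Finset (Fin (k + 1)) → ℝ) (j : Fin (k + 1))) = fun j : {x // x ∉ B} => realF (j : Fin (k + 1)) := by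
    funext j
    have hj : (j : Fin (k + 1)) ≠ Fin.last k := fun h => j.2 (h ▸ hB)
    obtain ⟨j', hj'⟩ := Fin.exists_castSucc_eq.2 hj
    rw [← hj', gFam_castSucc]
  unfold coRest
  rw [e1]

/-- **The complementary factor of a proper block is minus an honest sub-functional**: for `B ≠ univ` there is an
embedding `e` of some `Fin (n+1)` onto `Bᶜ` with `coRest (realW β) realF B = −Φ_{n+1}(S ↦ β(e(S)))`
([LiebSahi2021, Prop. 3.4] in the canonical model, re-indexed). [this work] -/
theorem coRest_realF_eq (β : Finset (Fin (k + 1)) → ℝ) {B : Finset (Fin (k + 1))} (hBu : B ≠ univ) :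
    ∃ (n : ℕ) (e : Fin (n + 1) ↪ Fin (k + 1)), (∀ j, e j ∉ B) ∧
      coRest (realW β) realF B = -phiSet (n + 1) (fun S => β (S.map e)) := by
  obtain ⟨y, hy⟩ : ∃ y, y ∉ B := not_forall.1 (mt eq_univ_iff_forall.2 hBu)
  have hN : 0 < Fintype.card {x // x ∉ B} := Fintype.card_pos_iff.2 ⟨⟨y, hy⟩⟩
  obtain ⟨n, hn⟩ : ∃ n, Fintype.card {x // x ∉ B} = n + 1 := ⟨Fintype.card {x // x ∉ B} - 1, by omega⟩
  let e0 : Fin (n + 1) ≃ {x // x ∉ B} := ((Fintype.equivFin {x // x ∉ B}).trans (finCongr hn)).symm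
  let e : Fin (n + 1) ↪ Fin (k + 1) := e0.toEmbedding.trans (Embedding.subtype _)
  refine ⟨n, e, fun j => (e0 j).2, ?_⟩
  rw [coRest_of_ne_univ _ _ hBu, ← cycleSum_comp_equiv (realW β) e0 (fun j : {x // x ∉ B} => realF (j : Fin (k + 1))),
    ← sahiE_eq_cycleSum (realW β) (Nat.succ_le_succ (Nat.zero_le n)), PrincipalCapBeta.sahiE_eq_phiSet]
  congr 2
  funext S
  have e1 : (∏ x ∈ S, realF ((e0 x : {x // x ∉ B}) : Fin (k + 1))) = ∏ x ∈ S.map e, realF x := by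
    rw [prod_map]; rfl
  rw [e1, PrincipalCapBeta.ex_realW_prod]

/-! ### The abstract step -/

/-- **`F(k+1)` on the cap face.**  If `β ≤ 1` and `β_B = 1` for every `B` containing the last index, then `Φ_{k+1}(β) ≥ 0`;
indeed `Φ_{k+1}(β) = Σ_{σ ∈ S_k} ∏_{c ∈ cyc σ} (1 − β_c)` is the absorption factor of the comparison family. [this work] -/
theorem phiSet_nonneg_of_last_eq_one (β : Finset (Fin (k + 1)) → ℝ) (h1 : ∀ B, β B ≤ 1)
    (hcap : ∀ B, Fin.last k ∈ B → β B = 1) : 0 ≤ phiSet (k + 1) β := by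
  set μ := realW β with hμ
  have hk : 1 ≤ k + 1 := Nat.succ_le_succ (Nat.zero_le k)
  have huniv : β univ = 1 := hcap univ (mem_univ _)
  have hG : 0 ≤ sahiE μ (k + 1) (Fin.snoc (fun j : Fin k => realF j.castSucc) (∏ i : Fin (k + 1), realF i) : Fin (k + 1) → Finset (Fin (k + 1)) → ℝ) := by
    have e1 : sahiE μ (k + 1) (Fin.snoc (fun j : Fin k => realF j.castSucc) (∏ i : Fin (k + 1), realF i) : Fin (k + 1) → Finset (Fin (k + 1)) → ℝ) = SahiJoinAbsorption.absorbFactor μ 1 k (fun j : Fin k => realF j.castSucc) * ex μ (∏ i : Fin (k + 1), realF i) :=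
      SahiJoinAbsorption.sahiE_snoc_eq_of_absorbing μ (fun j : Fin k => realF j.castSucc) (∏ i : Fin (k + 1), realF i) fTop_mul_realF
    rw [e1, ex_fTop, huniv, mul_one]
    refine absorbFactor_one_nonneg_of_moments μ k (fun j : Fin k => realF j.castSucc) fun S _ => ?_
    rw [ex_prod_realF_castSucc]
    exact h1 _
  have eF := sahiE_eq_sum_blocks μ hk realF (Fin.last k)
  have eG := sahiE_eq_sum_blocks μ hk (Fin.snoc (fun j : Fin k => realF j.castSucc) (∏ i : Fin (k + 1), realF i) : Fin (k + 1) → Finset (Fin (k + 1)) → ℝ) (Fin.last k)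
  rw [PrincipalCapBeta.phiSet_eq_sahiE_real, eF]
  rw [eG] at hG
  refine le_trans hG (le_of_eq (sum_congr rfl fun B hB => ?_))
  have hlast : Fin.last k ∈ B := (mem_filter.1 hB).2
  have mF : ex μ (fun x => ∏ j ∈ B, realF j x) = β B := by
    have e1 : (fun x => ∏ j ∈ B, realF j x) = ∏ j ∈ B, (realF j : Finset (Fin (k + 1)) → ℝ) :=
      funext fun x => (Finset.prod_apply x B _).symm
    rw [e1, PrincipalCapBeta.ex_realW_prod]
  have mG : ex μ (fun x => ∏ j ∈ B, (Fin.snoc (fun j : Fin k => realF j.castSucc) (∏ i : Fin (k + 1), realF i) : Fin (k + 1) → Finset (Fin (k + 1)) → ℝ) j x) = 1 := by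
    have e1 : (fun x => ∏ j ∈ B, (Fin.snoc (fun j : Fin k => realF j.castSucc) (∏ i : Fin (k + 1), realF i) : Fin (k + 1) → Finset (Fin (k + 1)) → ℝ) j x) =
        ∏ j ∈ B, (Fin.snoc (fun j : Fin k => realF j.castSucc) (∏ i : Fin (k + 1), realF i) : Fin (k + 1) → Finset (Fin (k + 1)) → ℝ) j :=
      funext fun x => (Finset.prod_apply x B _).symm
    rw [e1, prod_gFam_eq_fTop hlast, ex_fTop, huniv]
  rw [mF, mG, coRest_gFam_eq μ hlast, hcap B hlast]

/-- **THE ABSTRACT STEP (every order).**  Let `β : Finset (Fin (k+1)) → ℝ` with `β ≤ 1` and `β univ = 1`, and suppose every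
honest sub-functional avoiding the last index is nonnegative: `0 ≤ Φ_{n+1}(S ↦ β(e(S)))` for every embedding
`e : Fin (n+1) ↪ Fin (k+1)` that misses `Fin.last k`.  Then `0 ≤ Φ_{k+1}(β)`.  (Neither supermultiplicativity nor `β ≥ 0` is
used: block expansion along the last index, `β_B ≤ 1` against the nonpositive complementary factors, and positivity of the
absorption factor of the comparison family.) [this work] -/
theorem phiSet_nonneg_of_subfamilies (β : Finset (Fin (k + 1)) → ℝ) (h1 : ∀ B, β B ≤ 1) (huniv : β univ = 1)
    (hsub : ∀ (n : ℕ) (e : Fin (n + 1) ↪ Fin (k + 1)), (∀ j, e j ≠ Fin.last k) →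
      0 ≤ phiSet (n + 1) (fun S => β (S.map e))) :
    0 ≤ phiSet (k + 1) β := by
  set μ := realW β with hμ
  have hk : 1 ≤ k + 1 := Nat.succ_le_succ (Nat.zero_le k)
  -- the comparison family has nonnegative functional: the absorption factor under the moment bounds `β ≤ 1`
  have hG : 0 ≤ sahiE μ (k + 1) (Fin.snoc (fun j : Fin k => realF j.castSucc) (∏ i : Fin (k + 1), realF i) : Fin (k + 1) → Finset (Fin (k + 1)) → ℝ) := by
    have e1 : sahiE μ (k + 1) (Fin.snoc (fun j : Fin k => realF j.castSucc) (∏ i : Fin (k + 1), realF i) : Fin (k + 1) → Finset (Fin (k + 1)) → ℝ) = SahiJoinAbsorption.absorbFactor μ 1 k (fun j : Fin k => realF j.castSucc) * ex μ (∏ i : Fin (k + 1), realF i) :=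
      SahiJoinAbsorption.sahiE_snoc_eq_of_absorbing μ (fun j : Fin k => realF j.castSucc) (∏ i : Fin (k + 1), realF i) fTop_mul_realF
    rw [e1, ex_fTop, huniv, mul_one]
    refine absorbFactor_one_nonneg_of_moments μ k (fun j : Fin k => realF j.castSucc) fun S _ => ?_
    rw [ex_prod_realF_castSucc]
    exact h1 _
  -- block expansions along the last slot, in the same signed model
  have eF := sahiE_eq_sum_blocks μ hk realF (Fin.last k)
  have eG := sahiE_eq_sum_blocks μ hk (Fin.snoc (fun j : Fin k => realF j.castSucc) (∏ i : Fin (k + 1), realF i) : Fin (k + 1) → Finset (Fin (k + 1)) → ℝ) (Fin.last k)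
  rw [PrincipalCapBeta.phiSet_eq_sahiE_real, eF]
  rw [eG] at hG
  refine le_trans hG (sum_le_sum fun B hB => ?_)
  have hlast : Fin.last k ∈ B := (mem_filter.1 hB).2
  have mF : ex μ (fun x => ∏ j ∈ B, realF j x) = β B := by
    have e1 : (fun x => ∏ j ∈ B, realF j x) = ∏ j ∈ B, (realF j : Finset (Fin (k + 1)) → ℝ) :=
      funext fun x => (Finset.prod_apply x B _).symm
    rw [e1, PrincipalCapBeta.ex_realW_prod]
  have mG : ex μ (fun x => ∏ j ∈ B, (Fin.snoc (fun j : Fin k => realF j.castSucc) (∏ i : Fin (k + 1), realF i) : Fin (k + 1) → Finset (Fin (k + 1)) → ℝ) j x) = 1 := by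
    have e1 : (fun x => ∏ j ∈ B, (Fin.snoc (fun j : Fin k => realF j.castSucc) (∏ i : Fin (k + 1), realF i) : Fin (k + 1) → Finset (Fin (k + 1)) → ℝ) j x) =
        ∏ j ∈ B, (Fin.snoc (fun j : Fin k => realF j.castSucc) (∏ i : Fin (k + 1), realF i) : Fin (k + 1) → Finset (Fin (k + 1)) → ℝ) j :=
      funext fun x => (Finset.prod_apply x B _).symm
    rw [e1, prod_gFam_eq_fTop hlast, ex_fTop, huniv]
  rw [mF, mG, coRest_gFam_eq μ hlast]
  refine mul_le_mul_of_nonneg_left ?_ (Nat.cast_nonneg _)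
  by_cases hBu : B = univ
  · have hb : β B = 1 := by rw [hBu, huniv]
    rw [hb]
  · obtain ⟨n, e, he, hc⟩ := coRest_realF_eq β hBu
    have hc0 : coRest μ realF B ≤ 0 := by
      rw [hc, neg_nonpos]
      exact hsub n e fun j hj => he j (hj ▸ hlast)
    nlinarith [h1 B, hc0]

end Model

/-! ### Events: the inductive step on the principal-cap stratum -/

section Events

variable {ι : Type} [Fintype ι] {k : ℕ}

open PrincipalCapBeta (cyl coreP mom beta cores_of_principalCap sahiE_ind_eq_mul_phiSet beta_le_one beta_univ coreP_nonneg)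

/-- The conditional moments of a re-indexed sub-family are the re-indexed conditional moments. [this work] -/
theorem beta_comp_emb (p : ι → unitInterval) (U : Fin (k + 1) → Set (Set ι)) (K : Fin (k + 1) → Finset ι)
    {n : ℕ} (e : Fin (n + 1) ↪ Fin (k + 1)) (S : Finset (Fin (n + 1))) :
    beta p (fun j => U (e j)) (fun j => K (e j)) S = beta p U K (S.map e) := by
  unfold beta mom
  have hI : (⋂ j ∈ S.map e, U j) = ⋂ j ∈ S, U (e j) := by
    rw [map_eq_image, set_biInter_finset_image]
  have hP : ∏ j ∈ S.map e, coreP p K j = ∏ j ∈ S, coreP p (fun j => K (e j)) j := by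
    rw [prod_map]; rfl
  rw [hI, hP]

/-- **THE INDUCTIVE STEP ON THE PRINCIPAL-CAP STRATUM (every order, fine form).**  Let `U_0,…,U_k` be increasing events on a
finite product of two-point spaces whose common part is a principal up-set `{T | c ⊆ T}`.  If Sahi's functional is
nonnegative on every sub-family avoiding `U_k` — `E_{n+1}(μ_p; 1_{U_{e 0}},…,1_{U_{e n}}) ≥ 0` for every embedding `e` missing the
last index — then `E_{k+1}(μ_p; 1_{U_0},…,1_{U_k}) ≥ 0`. [this work] -/
theorem sahiE_ind_nonneg_principalCap_of_subfamilies (p : ι → unitInterval) (U : Fin (k + 1) → Set (Set ι))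
    (hU : ∀ j, IsUpperSet (U j)) (c : Finset ι) (hpc : ∀ T : Set ι, (∀ j, T ∈ U j) ↔ (↑c : Set ι) ⊆ T)
    (hsubE : ∀ (n : ℕ) (e : Fin (n + 1) ↪ Fin (k + 1)), (∀ j, e j ≠ Fin.last k) →
      0 ≤ sahiE (bernoulliWeight p) (n + 1) (fun j => ind (U (e j)))) :
    0 ≤ sahiE (bernoulliWeight p) (k + 1) (fun j => ind (U j)) := by
  obtain ⟨K, hdisj, hsub, hcap⟩ := cores_of_principalCap hU c hpc
  rw [sahiE_ind_eq_mul_phiSet p U K hdisj hsub]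
  by_cases hP : ∏ j, coreP p K j = 0
  · rw [hP, zero_mul]
  refine mul_nonneg (prod_nonneg fun j _ => coreP_nonneg p K j)
    (phiSet_nonneg_of_subfamilies _ (beta_le_one p hdisj hsub) (beta_univ p hdisj hsub hcap hP) fun n e he => ?_)
  have hdisj' : ∀ i j, i ≠ j → Disjoint (K (e i)) (K (e j)) :=
    fun i j hij => hdisj _ _ fun h => hij (e.injective h)
  have hsub' : ∀ j, U (e j) ⊆ cyl (K (e j)) := fun j => hsub (e j)
  have hE := sahiE_ind_eq_mul_phiSet p (fun j => U (e j)) (fun j => K (e j)) hdisj' hsub'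
  have hPe : 0 < ∏ j, coreP p (fun j => K (e j)) j :=
    prod_pos fun j _ => lt_of_le_of_ne (coreP_nonneg p _ j)
      (Ne.symm (prod_ne_zero_iff.1 hP (e j) (mem_univ _)))
  have hβ : beta p (fun j => U (e j)) (fun j => K (e j)) = fun S => beta p U K (S.map e) :=
    funext (beta_comp_emb p U K e)
  have h0 := hsubE n e he
  rw [hE, hβ] at h0
  exact (mul_nonneg_iff_of_pos_left hPe).1 h0

/-- **THE INDUCTIVE STEP, `MasterFamilyNonneg` form (every order): `C_{≤k} ⇒ C_{k+1}` on the principal-cap stratum.**  If Sahi's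
`C_{n+1}` holds for increasing events under product measures for every `n + 1 ≤ k`, then every family of `k + 1` increasing
events with principal common part has `E_{k+1} ≥ 0` — a minimal-order counterexample to Sahi's conjecture over product
measures is never principal-cap.  HONEST FRAMING: conditional; `C_k` is OPEN for `k ≥ 3`. [this work] -/
theorem sahiE_ind_nonneg_principalCap_of_masterFamilyNonneg (hN : ∀ n, n + 1 ≤ k → MasterFamilyNonneg (n + 1))
    (p : ι → unitInterval) (U : Fin (k + 1) → Set (Set ι)) (hU : ∀ j, IsUpperSet (U j)) (c : Finset ι)
    (hpc : ∀ T : Set ι, (∀ j, T ∈ U j) ↔ (↑c : Set ι) ⊆ T) :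
    0 ≤ sahiE (bernoulliWeight p) (k + 1) (fun j => ind (U j)) := by
  refine sahiE_ind_nonneg_principalCap_of_subfamilies p U hU c hpc fun n e he => ?_
  have hsubset : univ.map e ⊆ univ.erase (Fin.last k) := by
    intro x hx
    obtain ⟨j, _, rfl⟩ := mem_map.1 hx
    exact mem_erase.2 ⟨he j, mem_univ _⟩
  have h := card_le_card hsubset
  rw [card_map, card_univ, Fintype.card_fin, card_erase_of_mem (mem_univ _), card_univ, Fintype.card_fin] at h
  have hn : n + 1 ≤ k := by omega
  exact hN n hn ι p (fun j => U (e j)) fun j => hU (e j)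

/-- **Any member may be the exempted one** (symmetry of `E_n`): if Sahi's functional is nonnegative on every sub-family
avoiding `U_i`, a principal-cap family of increasing events has `E_{k+1} ≥ 0`. [this work] -/
theorem sahiE_ind_nonneg_principalCap_of_subfamilies' (p : ι → unitInterval) (U : Fin (k + 1) → Set (Set ι))
    (hU : ∀ j, IsUpperSet (U j)) (c : Finset ι) (hpc : ∀ T : Set ι, (∀ j, T ∈ U j) ↔ (↑c : Set ι) ⊆ T)
    (i : Fin (k + 1))
    (hsubE : ∀ (n : ℕ) (e : Fin (n + 1) ↪ Fin (k + 1)), (∀ j, e j ≠ i) →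
      0 ≤ sahiE (bernoulliWeight p) (n + 1) (fun j => ind (U (e j)))) :
    0 ≤ sahiE (bernoulliWeight p) (k + 1) (fun j => ind (U j)) := by
  let σ : Equiv.Perm (Fin (k + 1)) := Equiv.swap i (Fin.last k)
  have hperm := sahiE_comp_perm (bernoulliWeight p) (k + 1) σ (fun j => ind (U j))
  rw [← hperm]
  refine sahiE_ind_nonneg_principalCap_of_subfamilies p (fun j => U (σ j)) (fun j => hU (σ j)) c
    (fun T => ?_) fun n e he => ?_
  · rw [← hpc T]
    constructor
    · intro h j
      have := h (σ.symm j)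
      rwa [Equiv.apply_symm_apply] at this
    · intro h j
      exact h (σ j)
  · have he' : ∀ j, (e.trans σ.toEmbedding) j ≠ i := by
      intro j hj
      have h2 : σ (e j) = i := hj
      have h3 : e j = σ.symm i := by rw [← h2, Equiv.symm_apply_apply]
      rw [Equiv.symm_swap, Equiv.swap_apply_left] at h3
      exact he j h3
    exact hsubE n (e.trans σ.toEmbedding) he'

end Events

end PrincipalCapStep

end Summit.CriticalPhenomena.PercolationContinuityZ3.Theorems
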